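import Summits.BirchSwinnertonDyer.Rank1Residual.Additive.X3SemistableTwistRankZeroThreeClass
import Summits.BirchSwinnertonDyer.Rank1Residual.Additive.X3RankZeroCyclotomicThreeNoMilneFacts
import Summits.BirchSwinnertonDyer.Rank1Residual.Additive.XSplitMultRankZeroCyclotomicThreeNoMilneFacts
import Summits.BirchSwinnertonDyer.Rank1Residual.Additive.XMultRankZeroCyclotomicThreeNoMilneFacts
import HarnessLib

/-!
# X3 ∧ semistable twist at `p = 3`, ranks `(0,0)`: the class theorems over `K = ℚ(ζ₃)` (lines V14 / V15 / V16 assembled) — Milne's A73 PROVED AWAY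
# (cell `b2b-bsdres`, team n1011, seat p16 GEN 11; lead R5-87 (e) (W2) = additive-p4 GEN 23 word: the
# UPPER / two-sided no-Milne twins of the additive-p4 ℚ(ζ₃) lines are the p16 lineage's; row T-MIL-CAN)

HONEST FRAMING (cell `b2b-bsdres`, run/shared/lean/b2b/bsd-rank1-residual/, verbatim in every
file): the goal of the cell is to DELETE the COMBINATION-SHAPED residual classes of the
Birch–Swinnerton-Dyer formula for ALL analytic-rank `≤ 1` elliptic curves over `ℚ` — "full BSD
formula for every rank `≤ 1` curve in class `C`" assembled STRICTLY from published theorems — so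
that the rank-`≤ 1` remainder becomes exactly the CONSTRUCTION-SHAPED classes, which are TYPED
(missing-input `Prop`s), NOT attempted. This is not "finishing BSD". Team n1011 (N10 / N11), seat p16:
research route; X1 / X3 / X4 / X10 / N10 / N11 labels and marks UNCHANGED; nothing booked. Theorems only.

This file is `X3SemistableTwistRankZeroThreeClass.lean` (mathematics, census and references in THAT file's docstrings,
unchanged) with the Milne binder `hMilne : Milne1972.bsdQuotient_baseChange_quadratic_anyModel` (A73)
DELETED from every Milne-binding theorem and NOTHING added: each such theorem is re-issued under its name
with the suffix `_noMilne`, every other binder and every proof line byte-identical, every call to a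
Milne-binding tree theorem redirected to its no-Milne twin (`…_noLocal` cores / `…_noMilne` Facts of the
p16 lineage); Milne-free helpers of the source file are used as landed, not re-declared. What the
additive-p4 cores read from A73 — `Ш(V_K)` finite and the `3`-adic valuation of the card identity over
`K = ℚ(ζ₃)` — are the THEOREMS `shaFinite_baseChange_of_twist` and T-MIL-CAN FILE 4
`padicVal_card_identity_baseChange[_anyRank]_of_natAbs_discr_eq` (`|d_K| = 3`, `V` good or multiplicative
at `3`: the per-place fibre identities (T) at EVERY place — n1011-p01's T-MIL-3 H-5a with rows T-MIL-B2 /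
T-A233 inside). Every other displayed hypothesis (named facts, (⊇/K) where present, census bits,
certificates) is exactly the source file's. Labels UNCHANGED; nothing booked; no mark moves.
-/

noncomputable section

open scoped Classical

open WeierstrassCurve Literature.NumberTheory.EllipticCurves
  Literature.NumberTheory.EllipticCurves.ModularForms
  Literature.NumberTheory.EllipticCurves.Rank1Residual
  Literature.NumberTheory.EllipticCurves.Rank1Residual.Typed
  Summit.BirchSwinnertonDyer.Rank1Residual.AdditivePotMult

namespace Summit.BirchSwinnertonDyer.Rank1Residual.Additive

variable (V : WeierstrassCurve ℚ) [V.IsElliptic] [V.IsGloballyMinimal]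
  (W : WeierstrassCurve ℚ) [W.IsElliptic] [W.IsGloballyMinimal]

/-- **X3 at `p = 3`, class level, ranks `(0,0)`: the sum inequality.** Let `(W, 3)` be an X3 pair
(`ClassX3 W 3`: `W[3]` reducible, `W` additive at `3`, `W` globally minimal) and `V` a globally minimal
curve with `C • V^{(−3)} = W` which is SEMISTABLE at `3` (`Good V 3 ∨ Mult V 3`), both of analytic rank
`0`. Then `#Ш_an(V) = q_V`, `#Ш_an(W) = q_W` are rationals with
**`ord₃ #Ш(V) + ord₃ #Ш(W) ≤ ord₃ q_V + ord₃ q_W`**, granted the named published facts of lines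
V14/V15/V16: Wuthrich 2014 Thm. 16 over `ℚ(ζ₃)` in its three reduction flavours (`hW16`, `hW16ns`,
`hW16s`), Greenberg LNM 1716 Thm. 4.1 / pp. 112–113 over a number field (`hGr`, `hGrns`, `hGrs`),
Greenberg–Stevens for `V` (`hGS`, used only when `V` is split multiplicative at `3`), modularity (`hmod`, `hmodD`), Gross–Zagier–Kolyvagin (`hGZK`). Internally: good ⇒ ordinary
(`isOrdinaryAt_twist_of_classX3_of_good`), `¬ Irr V 3` (`red_twist_of_classX3`), and a `by_cases` on
split / non-split. [cite: Wuthrich2014, Thm. 16 (p. 397)] [cite: GreenbergLNM1716, Thm. 4.1 (p. 102) and §4 pp. 112–113]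
[cite: Milne1972ArithmeticAV, §1 Thm. 1 and §2 (through DokchitserDokchitserAnnals2010, §2.1, proof of Thm. 8)] -/
theorem ClassX3.exists_padicVal_shaOrder_add_le_three_of_semistableTwist_noMilne
    (hW16 : Wuthrich2014.charIdeal_dvd_padicLFunction_cyclotomicThree)
    (hW16ns : Wuthrich2014.thm16_charIdeal_dvd_nonsplitMultiplicative_cyclotomicThree)
    (hW16s : Wuthrich2014.thm16_charIdeal_dvd_splitMultiplicative_cyclotomicThree)
    (hGr : Greenberg1999.thm41_charValue_rankZero_numberField)
    (hGrns : Greenberg1999.thm41Analogue_charValue_rankZero_numberField)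
    (hGrs : Greenberg1999.thm41Analogue_charValue_rankZero_split_baseChange)
    (hGS : greenberg_stevens V 3)
    (hGZK : rank_eq_analyticRank_of_analyticRank_le_one) (hmod : hasEntireLFunction_rat)
    (hmodD : nonempty_modularParametrizationData)
    (hX : ClassX3 W 3) (C : VariableChange ℚ) (hC : C • V.quadraticTwist (-(3 : ℚ)) = W)
    (hsst : V.HasGoodReductionAtPrime 3 ∨ V.HasMultiplicativeReductionAtPrime 3)
    (hrV : V.analyticRank = 0) (hrW : W.analyticRank = 0) :
    ∃ qV qW : ℚ, shaAn V = (qV : ℂ) ∧ shaAn W = (qW : ℂ) ∧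
      (padicValNat 3 V.shaOrder : ℤ) + padicValNat 3 W.shaOrder ≤ padicValRat 3 qV + padicValRat 3 qW := by
  have hadd : Addv W 3 := hX.2
  have hred : ¬ V.HasIrreducibleModPGaloisRep 3 := red_twist_of_classX3 V W hX C hC
  rcases hsst with hgood | hmult
  · exact X3CyclotomicThree.exists_padicVal_shaOrder_add_le_of_facts_noMilne V W hW16 hGr hGZK hmod hmodD
      C hC (isOrdinaryAt_twist_of_classX3_of_good V W hX C hC hgood) hred hadd hrV hrW
  · by_cases hsplit : V.HasSplitMultiplicativeReductionAtPrime 3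
    · exact XSplitMultCyclotomicThree.exists_padicVal_shaOrder_add_le_of_facts_of_red_noMilne V W hW16s hGrs hGS
        hGZK hmod hmodD C hC hsplit hred hadd hrV hrW
    · exact XMultCyclotomicThree.exists_padicVal_shaOrder_add_le_of_facts_of_red_noMilne V W hW16ns hGrns
        hGZK hmod hmodD C hC hmult hsplit hred hadd hrV hrW

/-- **X3 at `p = 3`, class level: the cell's typed UPPER half for the additive curve.** In the
situation of `ClassX3.exists_padicVal_shaOrder_add_le_three_of_semistableTwist_noMilne`, if `#Ш_an(V)` has
non-positive `3`-adic valuation (census bit `3 ∤ #Ш_an(V)` of the twist pair) then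
`Typed.MissingUpperBoundAt W 3` (`ord₃ #Ш(W) ≤ ord₃ #Ш_an(W)`).
[cite: Wuthrich2014, Thm. 16 (p. 397)] [cite: GreenbergLNM1716, Thm. 4.1 (p. 102) and §4 pp. 112–113] -/
theorem ClassX3.missingUpperBoundAt_three_of_semistableTwist_noMilne
    (hW16 : Wuthrich2014.charIdeal_dvd_padicLFunction_cyclotomicThree)
    (hW16ns : Wuthrich2014.thm16_charIdeal_dvd_nonsplitMultiplicative_cyclotomicThree)
    (hW16s : Wuthrich2014.thm16_charIdeal_dvd_splitMultiplicative_cyclotomicThree)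
    (hGr : Greenberg1999.thm41_charValue_rankZero_numberField)
    (hGrns : Greenberg1999.thm41Analogue_charValue_rankZero_numberField)
    (hGrs : Greenberg1999.thm41Analogue_charValue_rankZero_split_baseChange)
    (hGS : greenberg_stevens V 3)
    (hGZK : rank_eq_analyticRank_of_analyticRank_le_one) (hmod : hasEntireLFunction_rat)
    (hmodD : nonempty_modularParametrizationData)
    (hX : ClassX3 W 3) (C : VariableChange ℚ) (hC : C • V.quadraticTwist (-(3 : ℚ)) = W)
    (hsst : V.HasGoodReductionAtPrime 3 ∨ V.HasMultiplicativeReductionAtPrime 3)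
    (hrV : V.analyticRank = 0) (hrW : W.analyticRank = 0)
    {qV : ℚ} (hqV : shaAn V = (qV : ℂ)) (hv : padicValRat 3 qV ≤ 0) :
    MissingUpperBoundAt W 3 := by
  obtain ⟨qV', qW, hqV', hqW, hle⟩ := ClassX3.exists_padicVal_shaOrder_add_le_three_of_semistableTwist_noMilne V W
    hW16 hW16ns hW16s hGr hGrns hGrs hGS hGZK hmod hmodD hX C hC hsst hrV hrW
  have hqq : qV' = qV := by exact_mod_cast hqV'.symm.trans hqV
  subst hqq
  refine ⟨qW, hqW, ?_⟩
  have h0 : (0 : ℤ) ≤ padicValNat 3 V.shaOrder := by positivity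
  linarith

/-- **X3 at `p = 3`, class level: `BSD(W,3) ∧ BSD(V,3)` on the doubly-unit rank-`(0,0)` rows.** In the
situation of `ClassX3.exists_padicVal_shaOrder_add_le_three_of_semistableTwist_noMilne`, if `#Ш_an(V)` and
`#Ш_an(W)` are `3`-adic units then Miller's `BSD(W,3)` (the ADDITIVE X3 pair) and `BSD(V,3)` (its
semistable Eisenstein twist pair, an X1/X2-type pair) hold simultaneously. Census (hyp cyc3 two-engine,
`N < 2·10⁴`): 243 of the 247 CORE-open rank-`(0,0)` X3 rows at `p = 3` with semistable twist are
doubly-unit. Labels UNCHANGED; nothing booked by this theorem.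
[cite: Wuthrich2014, Thm. 16 (p. 397)] [cite: GreenbergLNM1716, Thm. 4.1 (p. 102) and §4 pp. 112–113]
[cite: Milne1972ArithmeticAV, §1 Thm. 1 and §2 (through DokchitserDokchitserAnnals2010, §2.1, proof of Thm. 8)] [cite: Miller2011LMS, §1 and Def. 1.1] -/
theorem ClassX3.bsdp_three_of_semistableTwist_of_shaAn_units_noMilne
    (hW16 : Wuthrich2014.charIdeal_dvd_padicLFunction_cyclotomicThree)
    (hW16ns : Wuthrich2014.thm16_charIdeal_dvd_nonsplitMultiplicative_cyclotomicThree)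
    (hW16s : Wuthrich2014.thm16_charIdeal_dvd_splitMultiplicative_cyclotomicThree)
    (hGr : Greenberg1999.thm41_charValue_rankZero_numberField)
    (hGrns : Greenberg1999.thm41Analogue_charValue_rankZero_numberField)
    (hGrs : Greenberg1999.thm41Analogue_charValue_rankZero_split_baseChange)
    (hGS : greenberg_stevens V 3)
    (hGZK : rank_eq_analyticRank_of_analyticRank_le_one) (hmod : hasEntireLFunction_rat)
    (hmodD : nonempty_modularParametrizationData)
    (hX : ClassX3 W 3) (C : VariableChange ℚ) (hC : C • V.quadraticTwist (-(3 : ℚ)) = W)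
    (hsst : V.HasGoodReductionAtPrime 3 ∨ V.HasMultiplicativeReductionAtPrime 3)
    (hrV : V.analyticRank = 0) (hrW : W.analyticRank = 0)
    {qV qW : ℚ} (hqV : shaAn V = (qV : ℂ)) (hqW : shaAn W = (qW : ℂ))
    (hvV : padicValRat 3 qV = 0) (hvW : padicValRat 3 qW = 0) : BSDp W 3 ∧ BSDp V 3 := by
  obtain ⟨qV', qW', hqV', hqW', hle⟩ :=
    ClassX3.exists_padicVal_shaOrder_add_le_three_of_semistableTwist_noMilne V W hW16 hW16ns hW16s hGr hGrns hGrs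
      hGS hGZK hmod hmodD hX C hC hsst hrV hrW
  have hqq : qV' = qV := by exact_mod_cast hqV'.symm.trans hqV
  have hqq' : qW' = qW := by exact_mod_cast hqW'.symm.trans hqW
  subst hqq hqq'
  rw [hvV, hvW, add_zero] at hle
  have hV0 : (0 : ℤ) ≤ padicValNat 3 V.shaOrder := by positivity
  have hW0 : (0 : ℤ) ≤ padicValNat 3 W.shaOrder := by positivity
  have huW : MissingUpperBoundAt W 3 := ⟨qW', hqW', by rw [hvW]; linarith⟩
  have huV : MissingUpperBoundAt V 3 := ⟨qV', hqV', by rw [hvV]; linarith⟩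
  exact ⟨bsdp_of_missingPPartAt W 3 hGZK (by rw [hrW]; exact zero_le_one)
      (missingPPartAt_of_upper_of_shaAn_unit W 3 huW hqW' hvW),
    bsdp_of_missingPPartAt V 3 hGZK (by rw [hrV]; exact zero_le_one)
      (missingPPartAt_of_upper_of_shaAn_unit V 3 huV hqV' hvV)⟩

/-! ### The (M)-cell: `Mult V 3` is a theorem of additive-p1 (`ClassX3M.mult_of_twist_model_negThree`) -/

/-- **X3♯(M) at `p = 3`, ranks `(0,0)`: the sum inequality with NO reduction datum on the twist.**
For `W` in additive-p1's class `ClassX3M W 3` (`ClassX3 W 3 ∧ v₃(j) < 0 ∧ 3 ≠ 2`) and ANY globally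
minimal `V` with `C • V^{(−3)} = W`, both of analytic rank `0`:
`ord₃ #Ш(V) + ord₃ #Ш(W) ≤ ord₃ #Ш_an(V) + ord₃ #Ш_an(W)`, from the named facts of lines V15/V16 (the
good-ordinary facts of V14 are not needed: `V` is multiplicative at `3`).
[cite: Wuthrich2014, Thm. 16 (p. 397)] [cite: GreenbergLNM1716, §4 pp. 112–113] [cite: SilvermanATAEC1994, V.5.3] -/
theorem ClassX3M.exists_padicVal_shaOrder_add_le_three_noMilne
    (hW16ns : Wuthrich2014.thm16_charIdeal_dvd_nonsplitMultiplicative_cyclotomicThree)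
    (hW16s : Wuthrich2014.thm16_charIdeal_dvd_splitMultiplicative_cyclotomicThree)
    (hGrns : Greenberg1999.thm41Analogue_charValue_rankZero_numberField)
    (hGrs : Greenberg1999.thm41Analogue_charValue_rankZero_split_baseChange)
    (hGS : greenberg_stevens V 3)
    (hGZK : rank_eq_analyticRank_of_analyticRank_le_one) (hmod : hasEntireLFunction_rat)
    (hmodD : nonempty_modularParametrizationData)
    (hX : ClassX3M W 3) (C : VariableChange ℚ) (hC : C • V.quadraticTwist (-(3 : ℚ)) = W)
    (hrV : V.analyticRank = 0) (hrW : W.analyticRank = 0) :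
    ∃ qV qW : ℚ, shaAn V = (qV : ℂ) ∧ shaAn W = (qW : ℂ) ∧
      (padicValNat 3 V.shaOrder : ℤ) + padicValNat 3 W.shaOrder ≤ padicValRat 3 qV + padicValRat 3 qW := by
  have hmult : V.HasMultiplicativeReductionAtPrime 3 := ClassX3M.mult_of_twist_model_negThree hX V C hC
  have hadd : Addv W 3 := hX.1.2
  have hred : ¬ V.HasIrreducibleModPGaloisRep 3 := red_twist_of_classX3 V W hX.1 C hC
  by_cases hsplit : V.HasSplitMultiplicativeReductionAtPrime 3
  · exact XSplitMultCyclotomicThree.exists_padicVal_shaOrder_add_le_of_facts_of_red_noMilne V W hW16s hGrs hGS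
      hGZK hmod hmodD C hC hsplit hred hadd hrV hrW
  · exact XMultCyclotomicThree.exists_padicVal_shaOrder_add_le_of_facts_of_red_noMilne V W hW16ns hGrns
      hGZK hmod hmodD C hC hmult hsplit hred hadd hrV hrW

/-- **X3♯(M) at `p = 3`: `BSD(W,3) ∧ BSD(V,3)` on the doubly-unit rank-`(0,0)` rows**, class-level form
of `XMultCyclotomicThree.…` / `XSplitMultCyclotomicThree.bsdp_of_shaAn_units_of_facts_of_red_noMilne` with the
multiplicativity of the twist discharged. Census (hyp cyc3, `N < 2·10⁴`): 165 of the 168 CORE-open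
rank-`(0,0)` X3 ∧ (M) rows at `p = 3`. Labels UNCHANGED; nothing booked.
[cite: Wuthrich2014, Thm. 16 (p. 397)] [cite: GreenbergLNM1716, §4 pp. 112–113] [cite: Miller2011LMS, §1 and Def. 1.1] -/
theorem ClassX3M.bsdp_three_of_shaAn_units_noMilne
    (hW16ns : Wuthrich2014.thm16_charIdeal_dvd_nonsplitMultiplicative_cyclotomicThree)
    (hW16s : Wuthrich2014.thm16_charIdeal_dvd_splitMultiplicative_cyclotomicThree)
    (hGrns : Greenberg1999.thm41Analogue_charValue_rankZero_numberField)
    (hGrs : Greenberg1999.thm41Analogue_charValue_rankZero_split_baseChange)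
    (hGS : greenberg_stevens V 3)
    (hGZK : rank_eq_analyticRank_of_analyticRank_le_one) (hmod : hasEntireLFunction_rat)
    (hmodD : nonempty_modularParametrizationData)
    (hX : ClassX3M W 3) (C : VariableChange ℚ) (hC : C • V.quadraticTwist (-(3 : ℚ)) = W)
    (hrV : V.analyticRank = 0) (hrW : W.analyticRank = 0)
    {qV qW : ℚ} (hqV : shaAn V = (qV : ℂ)) (hqW : shaAn W = (qW : ℂ))
    (hvV : padicValRat 3 qV = 0) (hvW : padicValRat 3 qW = 0) : BSDp W 3 ∧ BSDp V 3 := by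
  obtain ⟨qV', qW', hqV', hqW', hle⟩ :=
    ClassX3M.exists_padicVal_shaOrder_add_le_three_noMilne V W hW16ns hW16s hGrns hGrs hGS hGZK hmod hmodD
      hX C hC hrV hrW
  have hqq : qV' = qV := by exact_mod_cast hqV'.symm.trans hqV
  have hqq' : qW' = qW := by exact_mod_cast hqW'.symm.trans hqW
  subst hqq hqq'
  rw [hvV, hvW, add_zero] at hle
  have hV0 : (0 : ℤ) ≤ padicValNat 3 V.shaOrder := by positivity
  have hW0 : (0 : ℤ) ≤ padicValNat 3 W.shaOrder := by positivity
  have huW : MissingUpperBoundAt W 3 := ⟨qW', hqW', by rw [hvW]; linarith⟩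
  have huV : MissingUpperBoundAt V 3 := ⟨qV', hqV', by rw [hvV]; linarith⟩
  exact ⟨bsdp_of_missingPPartAt W 3 hGZK (by rw [hrW]; exact zero_le_one)
      (missingPPartAt_of_upper_of_shaAn_unit W 3 huW hqW' hvW),
    bsdp_of_missingPPartAt V 3 hGZK (by rw [hrV]; exact zero_le_one)
      (missingPPartAt_of_upper_of_shaAn_unit V 3 huV hqV' hvV)⟩

end Summit.BirchSwinnertonDyer.Rank1Residual.Additive

end
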